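import Summits.QuantumFields.YangMills.Theorems.ColdStartUniversalityLatticeLangevinCarreMollifier
import Summits.QuantumFields.YangMills.Theorems.ColdStartUniversalityLatticeLangevinPointwiseMixingUniform
import HarnessLib

/-!
# Route `ColdStartUniversality` (fixed-cut-off package, Bakry–Émery side, GRADIENT half): EVERY-START EXPONENTIAL MIXING FOR `C¹` (LIPSCHITZ)
# DATA — the `C⁵` hypothesis of `wilson_pointwise_mixing_of_carre_uniform` removed

Helper file (seat `ym-line-csu-p1`, g29; `--supports stmt-QuantumFields-24809`).  By the C⁵ approximation with carré du champ control
(`exists_contDiff_five_approx_of_carre_le`: `|g − f| ≤ η` on the group, `Γ^A(g) ≤ (σ+η)²`) and the every-start mixing theorem for `C⁵` data,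
letting `η → 0`:
* ★★★ `wilson_pointwise_mixing_of_contDiff_one` — at `|β'| < 1/12`, for every `C¹` `f` with `Γ^A(f) ≤ σ²` on the group, every realising Markov
  kernel family, every `t ≥ 0` and EVERY start `x`:  `|κ_t(f∘coords)(x) − ∫ f∘coords dμ_(β')| ≤ π·√#E·e^(−(1−12|β'|)t)·σ`;
* ★★★ `wilson_solution_pointwise_mixing_of_contDiff_one` — the same along every strong SZZ solution from a deterministic start;
* ★★ `wilson_initialLaw_mixing_of_contDiff_one` — the same for the semigroup started from an ARBITRARY initial law `ν` (e.g. the hot start).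
So the sup-norm convergence rate `ρ = 1 − 12|β'|` holds for all `C¹` cylinder observables with the sub-Riemannian Lipschitz constant
`sup √Γ^A(f)` — the natural (Wasserstein-type) class.  THEOREMS ONLY, no definition, no sorry.  [cite: BakryGentilLedoux2014, Thm 3.3.18;
ShenZhuZhu2022 §4].  HONEST FRAMING: fixed cut-off, FIXED `|β'| < 1/12`, uniform in `L`, start and time only; nothing `K`-uniform along the
route's scaling; `UniformColdStartMixing` (stmt-24809, aside) is NOT restated or weakened; the Yang–Mills mass gap is NOT proved.
-/

set_option autoImplicit false

noncomputable section

namespace Summit.QuantumFields.YangMills.Theorems.ColdStartUniversality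

open MeasureTheory ProbabilityTheory Matrix Complex Finset Filter Set Metric
open scoped ComplexConjugate BigOperators Matrix NNReal ENNReal Topology
open Literature.Probability.Process Literature.MathematicalPhysics.QuantumFieldTheory
open Literature.MathematicalPhysics.QuantumLattice (fundamentalRep fundamentalLatticeRep continuous_fundamentalRep fundamentalRep_apply)

variable {L : ℕ} [NeZero L]

/-- ★★★ **Every-start exponential mixing for `C¹` data.**  At `|β'| < 1/12`, for every `C¹` function `f` of the real link coordinates with
`Γ^A(f) ≤ σ²` on the group, every Markov kernel family `κ` realising the SZZ solutions, every `t ≥ 0` and EVERY configuration `x`: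
`|κ_t(f∘coords)(x) − ∫ f∘coords dμ_(β')| ≤ π·√#E·e^(−(1−12|β'|)t)·σ`. [cite: BakryGentilLedoux2014, Thm 3.3.18; ShenZhuZhu2022 §4] -/
theorem wilson_pointwise_mixing_of_contDiff_one (L : ℕ) [NeZero L] (β' : ℝ) (hβ : |β'| < 1 / 12)
    (κ : ℝ≥0 → Kernel (GaugeConfig 3 L (Matrix.specialUnitaryGroup (Fin 2) ℂ))
      (GaugeConfig 3 L (Matrix.specialUnitaryGroup (Fin 2) ℂ))) [∀ t, IsMarkovKernel (κ t)]
    (hreal : ∀ (t : ℝ≥0) (x : GaugeConfig 3 L (Matrix.specialUnitaryGroup (Fin 2) ℂ))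
        (Ω : Type) [MeasurableSpace Ω] (P : Measure Ω) [IsProbabilityMeasure P]
        (W : ℝ≥0 → Ω → (Edge 3 L × NoiseIdx 2 → ℝ)) (hW : IsFlatBrownian W P)
        (U : ℝ≥0 → Ω → GaugeConfig 3 L (Matrix.specialUnitaryGroup (Fin 2) ℂ)),
        (∀ ω, U 0 ω = x) →
        (latticeLangevinDynamics (fundamentalLatticeRep 2) β').IsSolution (fundamentalRep (Fin 2))
          hW.natFiltration P W U →
        κ t x = P.map (U t))
    {f : (Edge 3 L × Fin 2 × Fin 2 × Bool → ℝ) → ℝ} (hf : ContDiff ℝ 1 f) {σ : ℝ} (hσ : 0 ≤ σ) (t : ℝ≥0) :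
    let coords : GaugeConfig 3 L (Matrix.specialUnitaryGroup (Fin 2) ℂ) → (Edge 3 L × Fin 2 × Fin 2 × Bool → ℝ) :=
      fun V q => (fun z : ℂ => if q.2.2.2 then z.im else z.re)
        ((fundamentalRep (Fin 2) (V q.1) : Matrix (Fin 2) (Fin 2) ℂ) q.2.1 q.2.2.1)
    let A : GaugeConfig 3 L (Matrix.specialUnitaryGroup (Fin 2) ℂ) → (Edge 3 L × Fin 2 × Fin 2 × Bool) →
        (Edge 3 L × Fin 2 × Fin 2 × Bool) → ℝ := fun V i j =>
      ∑ n : Edge 3 L × NoiseIdx 2,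
        (if n.1 = i.1 then (fun z : ℂ => if i.2.2.2 then z.im else z.re)
          ((latticeLangevinDynamics (fundamentalLatticeRep 2) β').noise
            (matrixConfig (fundamentalRep (Fin 2)) V) i.1 n.2 i.2.1 i.2.2.1) else 0) *
        (if n.1 = j.1 then (fun z : ℂ => if j.2.2.2 then z.im else z.re)
          ((latticeLangevinDynamics (fundamentalLatticeRep 2) β').noise
            (matrixConfig (fundamentalRep (Fin 2)) V) j.1 n.2 j.2.1 j.2.2.1) else 0)
    (∀ y, (∑ i : Edge 3 L × Fin 2 × Fin 2 × Bool, ∑ j : Edge 3 L × Fin 2 × Fin 2 × Bool, fderiv ℝ f (coords y) (Pi.single i 1) * fderiv ℝ f (coords y) (Pi.single j 1) * A y i j) ≤ σ ^ 2) →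
    ∀ x, |∫ y, f (coords y) ∂(κ t x) - ∫ y, f (coords y) ∂(wilsonMeasure (d := 3) (L := L) (fundamentalRep (Fin 2)) β')| ≤ Real.pi * Real.sqrt (Fintype.card (Edge 3 L)) * (Real.exp (-((1 - 12 * |β'|) * (t : ℝ))) * σ) := by
  intro coords A hΓ x
  classical
  haveI := secondCountableTopology_su2
  haveI := borelSpace_config L
  haveI : IsProbabilityMeasure (wilsonMeasure (d := 3) (L := L) (fundamentalRep (Fin 2)) β') :=
    isProbabilityMeasure_wilsonMeasure (d := 3) (L := L) (fundamentalRep (Fin 2)) (continuous_fundamentalRep (Fin 2)) β'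
  have hco : Continuous coords := continuous_coords (L := L)
  have hP0 : 0 ≤ Real.pi * Real.sqrt (Fintype.card (Edge 3 L)) * Real.exp (-((1 - 12 * |β'|) * (t : ℝ))) := by positivity
  refine le_of_forall_pos_le_add fun ε hε => ?_
  -- tolerance `η` with `(π√#E e^(−ρt) + 2) η = ε`
  set η : ℝ := ε / (Real.pi * Real.sqrt (Fintype.card (Edge 3 L)) * Real.exp (-((1 - 12 * |β'|) * (t : ℝ))) + 2) with hη
  have hηpos : 0 < η := div_pos hε (by linarith)
  have hηε : Real.pi * Real.sqrt (Fintype.card (Edge 3 L)) * Real.exp (-((1 - 12 * |β'|) * (t : ℝ))) * η + 2 * η = ε := by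
    rw [hη]; field_simp
  obtain ⟨g, hg5, hg0, hgΓ⟩ := exists_contDiff_five_approx_of_carre_le L β' hf hσ hηpos hΓ
  have hg : |∫ y, g (coords y) ∂(κ t x) - ∫ y, g (coords y) ∂(wilsonMeasure (d := 3) (L := L) (fundamentalRep (Fin 2)) β')| ≤ Real.pi * Real.sqrt (Fintype.card (Edge 3 L)) * (Real.exp (-((1 - 12 * |β'|) * (t : ℝ))) * (σ + η)) :=
    wilson_pointwise_mixing_of_carre_uniform L β' hβ κ hreal hg5 (add_nonneg hσ hηpos.le) t hgΓ x
  -- the two integrals of `f` and `g` differ by at most `η` under any probability measure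
  have cF : Continuous fun y : (GaugeConfig 3 L (Matrix.specialUnitaryGroup (Fin 2) ℂ)) => f (coords y) := hf.continuous.comp hco
  have cG : Continuous fun y : (GaugeConfig 3 L (Matrix.specialUnitaryGroup (Fin 2) ℂ)) => g (coords y) := hg5.continuous.comp hco
  have hdiff : ∀ (ν : Measure (GaugeConfig 3 L (Matrix.specialUnitaryGroup (Fin 2) ℂ))) [IsProbabilityMeasure ν], |∫ y, f (coords y) ∂ν - ∫ y, g (coords y) ∂ν| ≤ η := by
    intro ν _
    rw [← integral_sub (integrable_of_continuous_of_compactSpace cF ν) (integrable_of_continuous_of_compactSpace cG ν)]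
    have h := norm_integral_le_of_norm_le_const (μ := ν) (f := fun y : (GaugeConfig 3 L (Matrix.specialUnitaryGroup (Fin 2) ℂ)) => f (coords y) - g (coords y)) (C := η)
      (ae_of_all _ fun y => by rw [Real.norm_eq_abs, abs_sub_comm]; exact hg0 y)
    rw [probReal_univ, mul_one, Real.norm_eq_abs] at h
    exact h
  have h1 := hdiff (κ t x)
  have h2 := hdiff (wilsonMeasure (d := 3) (L := L) (fundamentalRep (Fin 2)) β')
  rw [abs_sub_comm] at h2
  have hfin : |∫ y, f (coords y) ∂(κ t x) - ∫ y, f (coords y) ∂(wilsonMeasure (d := 3) (L := L) (fundamentalRep (Fin 2)) β')| ≤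
      η + (Real.pi * Real.sqrt (Fintype.card (Edge 3 L)) * (Real.exp (-((1 - 12 * |β'|) * (t : ℝ))) * (σ + η)) + η) :=
    calc |∫ y, f (coords y) ∂(κ t x) - ∫ y, f (coords y) ∂(wilsonMeasure (d := 3) (L := L) (fundamentalRep (Fin 2)) β')|
        ≤ |∫ y, f (coords y) ∂(κ t x) - ∫ y, g (coords y) ∂(κ t x)| + |∫ y, g (coords y) ∂(κ t x) - ∫ y, f (coords y) ∂(wilsonMeasure (d := 3) (L := L) (fundamentalRep (Fin 2)) β')| :=
          abs_sub_le _ _ _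
      _ ≤ |∫ y, f (coords y) ∂(κ t x) - ∫ y, g (coords y) ∂(κ t x)| +
            (|∫ y, g (coords y) ∂(κ t x) - ∫ y, g (coords y) ∂(wilsonMeasure (d := 3) (L := L) (fundamentalRep (Fin 2)) β')| + |∫ y, g (coords y) ∂(wilsonMeasure (d := 3) (L := L) (fundamentalRep (Fin 2)) β') - ∫ y, f (coords y) ∂(wilsonMeasure (d := 3) (L := L) (fundamentalRep (Fin 2)) β')|) :=
          add_le_add le_rfl (abs_sub_le _ _ _)
      _ ≤ η + (Real.pi * Real.sqrt (Fintype.card (Edge 3 L)) * (Real.exp (-((1 - 12 * |β'|) * (t : ℝ))) * (σ + η)) + η) := add_le_add h1 (add_le_add hg h2)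
  have hexpand : Real.pi * Real.sqrt (Fintype.card (Edge 3 L)) * (Real.exp (-((1 - 12 * |β'|) * (t : ℝ))) * (σ + η)) = Real.pi * Real.sqrt (Fintype.card (Edge 3 L)) * (Real.exp (-((1 - 12 * |β'|) * (t : ℝ))) * σ) + Real.pi * Real.sqrt (Fintype.card (Edge 3 L)) * Real.exp (-((1 - 12 * |β'|) * (t : ℝ))) * η := by ring
  linarith [hfin, hexpand, hηε]

/-- ★★★ **Every-start exponential mixing for `C¹` data along EVERY SZZ solution.**  At `|β'| < 1/12`: for every `L`, every `C¹` `f` with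
`Γ^A(f) ≤ σ²` on the group, every filtered probability space carrying a flat Brownian driver, every strong solution `U` of the SZZ Langevin
SDE from a deterministic start `U_0 ≡ x₀` and every `t ≥ 0`:  `|E[f(coords U_t)] − ∫ f∘coords dμ_(β')| ≤ π·√#E·e^(−(1−12|β'|)t)·σ`.
[cite: BakryGentilLedoux2014, Thm 3.3.18; ShenZhuZhu2022 §4] -/
theorem wilson_solution_pointwise_mixing_of_contDiff_one (L : ℕ) [NeZero L] (β' : ℝ) (hβ : |β'| < 1 / 12)
    {f : (Edge 3 L × Fin 2 × Fin 2 × Bool → ℝ) → ℝ} (hf : ContDiff ℝ 1 f) {σ : ℝ} (hσ : 0 ≤ σ) (t : ℝ≥0) (x₀ : (GaugeConfig 3 L (Matrix.specialUnitaryGroup (Fin 2) ℂ)))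
    (Ω : Type) [MeasurableSpace Ω] (P : Measure Ω) [IsProbabilityMeasure P]
    (W : ℝ≥0 → Ω → (Edge 3 L × NoiseIdx 2 → ℝ)) (hW : IsFlatBrownian W P)
    (U : ℝ≥0 → Ω → (GaugeConfig 3 L (Matrix.specialUnitaryGroup (Fin 2) ℂ))) (hU0 : ∀ ω, U 0 ω = x₀)
    (hU : (latticeLangevinDynamics (fundamentalLatticeRep 2) β').IsSolution (fundamentalRep (Fin 2)) hW.natFiltration P W U) :
    let coords : GaugeConfig 3 L (Matrix.specialUnitaryGroup (Fin 2) ℂ) → (Edge 3 L × Fin 2 × Fin 2 × Bool → ℝ) :=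
      fun V q => (fun z : ℂ => if q.2.2.2 then z.im else z.re)
        ((fundamentalRep (Fin 2) (V q.1) : Matrix (Fin 2) (Fin 2) ℂ) q.2.1 q.2.2.1)
    let A : GaugeConfig 3 L (Matrix.specialUnitaryGroup (Fin 2) ℂ) → (Edge 3 L × Fin 2 × Fin 2 × Bool) →
        (Edge 3 L × Fin 2 × Fin 2 × Bool) → ℝ := fun V i j =>
      ∑ n : Edge 3 L × NoiseIdx 2,
        (if n.1 = i.1 then (fun z : ℂ => if i.2.2.2 then z.im else z.re)
          ((latticeLangevinDynamics (fundamentalLatticeRep 2) β').noise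
            (matrixConfig (fundamentalRep (Fin 2)) V) i.1 n.2 i.2.1 i.2.2.1) else 0) *
        (if n.1 = j.1 then (fun z : ℂ => if j.2.2.2 then z.im else z.re)
          ((latticeLangevinDynamics (fundamentalLatticeRep 2) β').noise
            (matrixConfig (fundamentalRep (Fin 2)) V) j.1 n.2 j.2.1 j.2.2.1) else 0)
    (∀ y, (∑ i : Edge 3 L × Fin 2 × Fin 2 × Bool, ∑ j : Edge 3 L × Fin 2 × Fin 2 × Bool, fderiv ℝ f (coords y) (Pi.single i 1) * fderiv ℝ f (coords y) (Pi.single j 1) * A y i j) ≤ σ ^ 2) →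
    |∫ ω, f (coords (U t ω)) ∂P - ∫ y, f (coords y) ∂(wilsonMeasure (d := 3) (L := L) (fundamentalRep (Fin 2)) β')| ≤ Real.pi * Real.sqrt (Fintype.card (Edge 3 L)) * (Real.exp (-((1 - 12 * |β'|) * (t : ℝ))) * σ) := by
  intro coords A hΓ
  classical
  haveI := secondCountableTopology_su2
  haveI := borelSpace_config L
  obtain ⟨κ, hκ, -, hreal⟩ := exists_transitionKernel L β'
  haveI := hκ
  have h := wilson_pointwise_mixing_of_contDiff_one L β' hβ κ hreal hf hσ t hΓ x₀
  have hlaw : κ t x₀ = P.map (U t) := hreal t x₀ Ω P W hW U hU0 hU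
  have hmU : Measurable (U t) := (hU.adapted t).mono (hW.natFiltration.le t) le_rfl
  have cF : Continuous fun y : (GaugeConfig 3 L (Matrix.specialUnitaryGroup (Fin 2) ℂ)) => f (coords y) := hf.continuous.comp (continuous_coords (L := L))
  have e1 : ∫ y, f (coords y) ∂(κ t x₀) = ∫ ω, f (coords (U t ω)) ∂P := by
    rw [hlaw, integral_map hmU.aemeasurable cF.aestronglyMeasurable]
  rw [← e1]
  exact h

/-- ★★ **Mixing from an ARBITRARY initial law (e.g. the HOT start, Haar).**  At `|β'| < 1/12`, for every `C¹` `f` with `Γ^A(f) ≤ σ²` on the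
group, every realising Markov kernel family `κ`, every `t ≥ 0` and every probability measure `ν` on the configuration space:
`|∫ κ_t(f∘coords) dν − ∫ f∘coords dμ_(β')| ≤ π·√#E·e^(−(1−12|β'|)t)·σ` — the law `ν κ_t` of the Markov semigroup started from `ν` converges at the
volume-independent rate, uniformly in `ν` (integrate the every-start bound `wilson_pointwise_mixing_of_contDiff_one`).
[cite: BakryGentilLedoux2014, Thm 3.3.18; ShenZhuZhu2022 §4] -/
theorem wilson_initialLaw_mixing_of_contDiff_one (L : ℕ) [NeZero L] (β' : ℝ) (hβ : |β'| < 1 / 12)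
    (κ : ℝ≥0 → Kernel (GaugeConfig 3 L (Matrix.specialUnitaryGroup (Fin 2) ℂ))
      (GaugeConfig 3 L (Matrix.specialUnitaryGroup (Fin 2) ℂ))) [∀ t, IsMarkovKernel (κ t)]
    (hreal : ∀ (t : ℝ≥0) (x : GaugeConfig 3 L (Matrix.specialUnitaryGroup (Fin 2) ℂ))
        (Ω : Type) [MeasurableSpace Ω] (P : Measure Ω) [IsProbabilityMeasure P]
        (W : ℝ≥0 → Ω → (Edge 3 L × NoiseIdx 2 → ℝ)) (hW : IsFlatBrownian W P)
        (U : ℝ≥0 → Ω → GaugeConfig 3 L (Matrix.specialUnitaryGroup (Fin 2) ℂ)),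
        (∀ ω, U 0 ω = x) →
        (latticeLangevinDynamics (fundamentalLatticeRep 2) β').IsSolution (fundamentalRep (Fin 2))
          hW.natFiltration P W U →
        κ t x = P.map (U t))
    {f : (Edge 3 L × Fin 2 × Fin 2 × Bool → ℝ) → ℝ} (hf : ContDiff ℝ 1 f) {σ : ℝ} (hσ : 0 ≤ σ) (t : ℝ≥0)
    (ν : Measure (GaugeConfig 3 L (Matrix.specialUnitaryGroup (Fin 2) ℂ))) [IsProbabilityMeasure ν] :
    let coords : GaugeConfig 3 L (Matrix.specialUnitaryGroup (Fin 2) ℂ) → (Edge 3 L × Fin 2 × Fin 2 × Bool → ℝ) :=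
      fun V q => (fun z : ℂ => if q.2.2.2 then z.im else z.re)
        ((fundamentalRep (Fin 2) (V q.1) : Matrix (Fin 2) (Fin 2) ℂ) q.2.1 q.2.2.1)
    let A : GaugeConfig 3 L (Matrix.specialUnitaryGroup (Fin 2) ℂ) → (Edge 3 L × Fin 2 × Fin 2 × Bool) →
        (Edge 3 L × Fin 2 × Fin 2 × Bool) → ℝ := fun V i j =>
      ∑ n : Edge 3 L × NoiseIdx 2,
        (if n.1 = i.1 then (fun z : ℂ => if i.2.2.2 then z.im else z.re)
          ((latticeLangevinDynamics (fundamentalLatticeRep 2) β').noise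
            (matrixConfig (fundamentalRep (Fin 2)) V) i.1 n.2 i.2.1 i.2.2.1) else 0) *
        (if n.1 = j.1 then (fun z : ℂ => if j.2.2.2 then z.im else z.re)
          ((latticeLangevinDynamics (fundamentalLatticeRep 2) β').noise
            (matrixConfig (fundamentalRep (Fin 2)) V) j.1 n.2 j.2.1 j.2.2.1) else 0)
    (∀ y, (∑ i : Edge 3 L × Fin 2 × Fin 2 × Bool, ∑ j : Edge 3 L × Fin 2 × Fin 2 × Bool, fderiv ℝ f (coords y) (Pi.single i 1) * fderiv ℝ f (coords y) (Pi.single j 1) * A y i j) ≤ σ ^ 2) →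
    |∫ x, (∫ y, f (coords y) ∂(κ t x)) ∂ν - ∫ y, f (coords y) ∂(wilsonMeasure (d := 3) (L := L) (fundamentalRep (Fin 2)) β')| ≤ Real.pi * Real.sqrt (Fintype.card (Edge 3 L)) * (Real.exp (-((1 - 12 * |β'|) * (t : ℝ))) * σ) := by
  intro coords A hΓ
  classical
  haveI := secondCountableTopology_su2
  haveI := borelSpace_config L
  have h := wilson_pointwise_mixing_of_contDiff_one L β' hβ κ hreal hf hσ t hΓ
  have hco : Continuous coords := continuous_coords (L := L)
  have cF : Continuous fun y : (GaugeConfig 3 L (Matrix.specialUnitaryGroup (Fin 2) ℂ)) => f (coords y) := hf.continuous.comp hco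
  obtain ⟨C, hC⟩ : ∃ C, ∀ y : (GaugeConfig 3 L (Matrix.specialUnitaryGroup (Fin 2) ℂ)), |f (coords y)| ≤ C := by
    obtain ⟨C, hC⟩ := isCompact_univ.exists_bound_of_continuousOn cF.continuousOn
    exact ⟨C, fun y => by simpa [Real.norm_eq_abs] using hC y (Set.mem_univ y)⟩
  -- `x ↦ κ_t(f∘coords)(x)` is bounded and measurable, hence `ν`-integrable
  have hsm : StronglyMeasurable fun x : (GaugeConfig 3 L (Matrix.specialUnitaryGroup (Fin 2) ℂ)) => ∫ y, f (coords y) ∂(κ t x) :=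
    cF.stronglyMeasurable.integral_kernel (κ := κ t)
  have hbd : ∀ x : (GaugeConfig 3 L (Matrix.specialUnitaryGroup (Fin 2) ℂ)), |∫ y, f (coords y) ∂(κ t x)| ≤ C := fun x => by
    have hn := norm_integral_le_of_norm_le_const (μ := κ t x) (f := fun y : (GaugeConfig 3 L (Matrix.specialUnitaryGroup (Fin 2) ℂ)) => f (coords y)) (C := C)
      (ae_of_all _ fun y => by rw [Real.norm_eq_abs]; exact hC y)
    rw [probReal_univ, mul_one, Real.norm_eq_abs] at hn
    exact hn
  have hint : Integrable (fun x : (GaugeConfig 3 L (Matrix.specialUnitaryGroup (Fin 2) ℂ)) => ∫ y, f (coords y) ∂(κ t x)) ν :=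
    Integrable.of_bound hsm.aestronglyMeasurable C (ae_of_all _ fun x => by rw [Real.norm_eq_abs]; exact hbd x)
  have hdiff : ∫ x, (∫ y, f (coords y) ∂(κ t x)) ∂ν - ∫ y, f (coords y) ∂(wilsonMeasure (d := 3) (L := L) (fundamentalRep (Fin 2)) β') =
      ∫ x, ((∫ y, f (coords y) ∂(κ t x)) - ∫ y, f (coords y) ∂(wilsonMeasure (d := 3) (L := L) (fundamentalRep (Fin 2)) β')) ∂ν := by
    rw [integral_sub hint (integrable_const _), integral_const, smul_eq_mul, probReal_univ, one_mul]
  rw [hdiff]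
  have hn := norm_integral_le_of_norm_le_const (μ := ν)
    (f := fun x : (GaugeConfig 3 L (Matrix.specialUnitaryGroup (Fin 2) ℂ)) => (∫ y, f (coords y) ∂(κ t x)) - ∫ y, f (coords y) ∂(wilsonMeasure (d := 3) (L := L) (fundamentalRep (Fin 2)) β')) (C := Real.pi * Real.sqrt (Fintype.card (Edge 3 L)) * (Real.exp (-((1 - 12 * |β'|) * (t : ℝ))) * σ))
    (ae_of_all _ fun x => by rw [Real.norm_eq_abs]; exact h x)
  rw [probReal_univ, mul_one, Real.norm_eq_abs] at hn
  exact hn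

end Summit.QuantumFields.YangMills.Theorems.ColdStartUniversality
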